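import Summits.KontsevichZagierPeriods.KontsevichZagierPeriods.Theses.TerasomaMultiplication
import Summits.KontsevichZagierPeriods.KontsevichZagierPeriods.Theorems.TerasomaMultiplicationDasGapTwelveStubCubeSubstitution
import Summits.KontsevichZagierPeriods.KontsevichZagierPeriods.Theorems.TerasomaMultiplicationDasGapTwelveStubInvolutionFold
import Summits.KontsevichZagierPeriods.KontsevichZagierPeriods.Theorems.TerasomaMultiplicationDasGapTwelveStubInvolutionQuotient
import Summits.KontsevichZagierPeriods.KontsevichZagierPeriods.Theorems.TerasomaMultiplicationDasGapTwelveStubTwistNormalisation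
import Summits.KontsevichZagierPeriods.KontsevichZagierPeriods.Theorems.TerasomaMultiplicationDasGapTwelveStubLemniscaticBeta

/-!
# `DasGapTwelve` (stmt-KontsevichZagierPeriods-13215, route TerasomaMultiplication) — line
`picard-involution-quotient` (closing file)

The crux: `[∫_(0,1) x^(−11/12)(1−x)^(−3/4)] ~ [∫_(0,1) c₀·x^(−3/4)(1−x)^(−3/4)]`,
`c₀ = 2^(−1/4)·3^(3/8)·√(1+√3)` (`B(1/12,1/4) = c₀·B(1/4,1/4)`), as a `KZ.Equivalent` statement.

Line (idea card `Cruxes/DasGapTwelve/Ideas/picard-involution-quotient.md`): `x = t³` puts the left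
side on the Picard curve `v⁴ = t − t⁴` (`X⁴ = Y³ − 1`, automorphism group of order 48); the real
involution `τ₊ : t ↦ (1−t)/(1+2t)` folds away the `τ₊`-anti-invariant part of `3(t−t⁴)^(−3/4)dt`
(stub F); the quotient by the companion involution `τ₋` is the elliptic curve `V² = w³ − (3+2√3)w`
(`w² = (1+t+t²)/(t(1−t))`), a quartic twist of `y² = x³ − x`, onto whose unbounded real component the
arc `(0,1)` folds `2:1` (stub Q); untwisting (`x = √D·y`, `y = 1/s²`, stub T) and the lemniscatic
normalisation of `B(1/4,1/4)` (stub B) land both sides on `[(0,1), 4√2·c₀(1−s⁴)^(−1/2)]`.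
Rules 1a/1b/2 only, dimension one throughout. The five registered stubs are the imported files
`…StubCubeSubstitution` (E), `…StubInvolutionFold` (F), `…StubInvolutionQuotient` (Q, with its
`…Aux`), `…StubTwistNormalisation` (T), `…StubLemniscaticBeta` (B); `DasGapTwelve_of` is their
composition by `KZ.Equivalent.trans/symm` and concludes the route declaration
`Summit.KontsevichZagierPeriods.KontsevichZagierPeriods.Theses.TerasomaMultiplication.DasGapTwelve`
by name.

References: M. Kontsevich, D. Zagier, *Periods* (2001), §1.2 rules (1), (2).
-/

noncomputable section

open Set MeasureTheory

namespace Summit.KontsevichZagierPeriods.TerasomaMultiplication.DasGapTwelve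

open Literature.NumberTheory.Transcendental
open Summit.KontsevichZagierPeriods.KontsevichZagierPeriods.Theses.TerasomaMultiplication (DasGapTwelve)

/-- **The line closes the crux** (composition of the five stubs): `r ~ ρ₁ ~ ρ₂ ~ ρ₃ ~ ρ₄ ~ r'`
by `KZ.Equivalent.trans` / `KZ.Equivalent.symm`, the intermediate representations being supplied by
the existence halves of stubs E, F, Q, T. [folklore] -/
theorem DasGapTwelve_of : DasGapTwelve := by
  intro r r' hr hri hr' hri'
  obtain ⟨⟨ρ₁, hρ₁, hρ₁i⟩, hE⟩ := stub_cubeSubstitution r hr hri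
  obtain ⟨⟨ρ₂, hρ₂, hρ₂i⟩, hF⟩ := stub_involutionFold ρ₁ hρ₁ hρ₁i
  obtain ⟨⟨ρ₃, hρ₃, hρ₃i⟩, hQ⟩ := stub_involutionQuotient ρ₂ hρ₂ hρ₂i
  obtain ⟨⟨ρ₄, hρ₄, hρ₄i⟩, hT⟩ := stub_twistNormalisation ρ₃ hρ₃ hρ₃i
  have hB := stub_lemniscaticBeta r' hr' hri' ρ₄ hρ₄ hρ₄i
  exact ((((hE ρ₁ hρ₁ hρ₁i).trans (hF ρ₂ hρ₂ hρ₂i)).trans (hQ ρ₃ hρ₃ hρ₃i)).trans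
    (hT ρ₄ hρ₄ hρ₄i)).trans hB.symm

end Summit.KontsevichZagierPeriods.TerasomaMultiplication.DasGapTwelve

end
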